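import Summits.ValiantsHypothesis.ValiantsHypothesis.Theorems.MatrixDescartes.Negative.MatrixDescartesFalseOfTropicalMonster
import Literature.Computability.AlgebraicComplexity.BirkhoffShadowLowerBound

/-!
# Crux `MatrixDescartes` (stmt-ValiantsHypothesis-18050), line `Lift` — registered stub `stub_shadowEmbed`

THE EMBEDDING of the tropical door into plane shadows of a Birkhoff polytope.  A tropical design
`(d, v, ε)` of format `(m, K)` with `B + 1` pairwise distinct Leibniz terms `p k = (σₖ, λₖ)`, each
the unique optimum (`IsDominant`) of the `K`-class parametric assignment at an integer slope `θ k`,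
yields a linear map `L : ℝ^{N × N} → ℝ²` on the node set `N = Fin m × Fin (K + 2)` under which the
convex hull of the images of the permutation matrices of `N` has at least `B + 1` extreme points.

Construction (Section F of `Literature/…/BirkhoffShadowLowerBound.lean`, adapted from layered walks
to multi-class assignments).  Nodes: `(i, 0)` is COLUMN `i`, `(i, 1)` is ROW `i`, `(i, l + 2)` is
the PORT `(i, l)`.  The term `t = (σ, λ)` becomes the permutation `termPerm t`:
`(i, 0) ↦ (i, λ i + 2) ↦ (σ i, 1) ↦ (σ i, 0)`, every other port fixed.  The table `arcWt` weighs
the arc `column i → port (i, l)` by `(d l, 0)`, the arc `port (i, l) → row j` by `(0, −v j i l)`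
provided `ε j i l ≠ 0`, the arcs `row j → column j` and `port → itself` by `(0, 0)`; every other
pair is a PENALTY pair, weighted `(0, −W)` (`wt`).  The linear map `Lmap` reads `∑ᵤ w (u, ρ u)` off
the matrix of `ρ` (`Lmap_perm_apply`), so the functional `fnl θ : (x, y) ↦ θ x + y` evaluates on
the matrix of `termPerm t`, `t` present, to the tropical weight `tropWeight d v θ t`
(`score_termPerm`); a permutation using no penalty pair IS `termPerm t` for a present `t`
(`exists_term_of_pattern`); a permutation using a penalty pair scores below every dominant term
once `W` exceeds the sum of all the finite data (`score_le`).  Hence the image `z k` of the matrix of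
`termPerm (p k)` is the strict unique maximiser of `fnl (θ k)` over the image set — a vertex, by the
tree lemma `BirkhoffShadowLower.mem_extremePoints_convexHull_of_forall_lt` — and the `z k` are
pairwise distinct by dominance; the extreme points form a finite set, so `B + 1 ≤ ncard`.

Elementary; Mathlib plus the tree lemma above (axioms `propext`, `Classical.choice`, `Quot.sound`).
-/

-- layout Summits/ValiantsHypothesis/ValiantsHypothesis forces the duplicated namespace component
set_option linter.dupNamespace false

namespace Summit.ValiantsHypothesis.ValiantsHypothesis.Theorems.LacunarySymmetroidMatrixDescartes

open Summit.ValiantsHypothesis.ValiantsHypothesis.Theorems.MatrixDescartes.Negative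

noncomputable section

namespace StubShadowEmbed

variable {m K : ℕ}

/-! #### Nodes `Fin m × Fin (K + 2)`: `(i, 0)` column, `(i, 1)` row, `(i, l.succ.succ)` port -/

/-- Every second coordinate is a column, a row or a port coordinate. -/
theorem fin_cases3 (b : Fin (K + 2)) : b = 0 ∨ b = 1 ∨ ∃ l : Fin K, b = l.succ.succ :=
  Fin.cases (Or.inl rfl) (fun b => Fin.cases (Or.inr (Or.inl rfl)) (fun l => Or.inr (Or.inr ⟨l, rfl⟩)) b) b

/-- The column coordinate is not a port coordinate. -/
@[simp] theorem zero_ne_succ_succ (l : Fin K) : (0 : Fin (K + 2)) ≠ l.succ.succ :=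
  (Fin.succ_ne_zero _).symm

/-- A port coordinate is not the row coordinate. -/
@[simp] theorem succ_succ_ne_one (l : Fin K) : (l.succ.succ : Fin (K + 2)) ≠ 1 :=
  Fin.succ_succ_ne_one l

/-- The row coordinate is not a port coordinate. -/
@[simp] theorem one_ne_succ_succ (l : Fin K) : (1 : Fin (K + 2)) ≠ l.succ.succ :=
  (Fin.succ_succ_ne_one l).symm

/-- Read a function of the port index at a coordinate `b = l + 2` (zero on non-ports). -/
def atPort {α : Type*} [Zero α] (f : Fin K → α) (b : Fin (K + 2)) : α :=
  if h : 2 ≤ b.val then f ⟨b.val - 2, by have := b.isLt; omega⟩ else 0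

/-- `atPort f (l + 2) = f l`. -/
@[simp] theorem atPort_succ_succ {α : Type*} [Zero α] (f : Fin K → α) (l : Fin K) :
    atPort f (l.succ.succ : Fin (K + 2)) = f l := by
  unfold atPort
  rw [dif_pos (by simp only [Fin.val_succ]; omega)]
  exact congrArg f (Fin.ext (by simp only [Fin.val_succ]; omega))

/-! #### Leibniz terms as permutations of the nodes -/

/-- The node map of the term `t = (σ, λ)`: column `i ↦` port `(i, λ i)`, row `j ↦` column `j`,
port `(i, λ i) ↦` row `σ i`, every other port fixed. -/
def termMap (t : Equiv.Perm (Fin m) × (Fin m → Fin K)) (u : Fin m × Fin (K + 2)) :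
    Fin m × Fin (K + 2) :=
  if u.2 = 0 then (u.1, (t.2 u.1).succ.succ)
  else if u.2 = 1 then (u.1, 0)
  else if u.2 = (t.2 u.1).succ.succ then (t.1 u.1, 1)
  else u

/-- The inverse node map: column `j ↤` row `j`, row `j ↤` port `(σ⁻¹ j, λ (σ⁻¹ j))`, port
`(i, λ i) ↤` column `i`, every other port fixed. -/
def termInv (t : Equiv.Perm (Fin m) × (Fin m → Fin K)) (u : Fin m × Fin (K + 2)) :
    Fin m × Fin (K + 2) :=
  if u.2 = 0 then (u.1, 1)
  else if u.2 = 1 then (t.1.symm u.1, (t.2 (t.1.symm u.1)).succ.succ)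
  else if u.2 = (t.2 u.1).succ.succ then (u.1, 0)
  else u

/-- The node map of a term is injective (`termInv t` is a left inverse). -/
theorem termMap_injective (t : Equiv.Perm (Fin m) × (Fin m → Fin K)) :
    Function.Injective (termMap t) := by
  refine Function.LeftInverse.injective (g := termInv t) fun ⟨i, b⟩ => ?_
  rcases fin_cases3 b with rfl | rfl | ⟨l, rfl⟩
  · simp [termMap, termInv]
  · simp [termMap, termInv]
  · by_cases hl : l = t.2 i
    · subst hl; simp [termMap, termInv]
    · simp [termMap, termInv, hl]

/-- The permutation of the nodes attached to the term `t = (σ, λ)`. -/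
def termPerm (t : Equiv.Perm (Fin m) × (Fin m → Fin K)) : Equiv.Perm (Fin m × Fin (K + 2)) :=
  Equiv.ofBijective (termMap t) (termMap_injective t).bijective_of_finite

/-- `termPerm t` acts by `termMap t`. -/
@[simp] theorem termPerm_apply (t : Equiv.Perm (Fin m) × (Fin m → Fin K))
    (u : Fin m × Fin (K + 2)) : termPerm t u = termMap t u := rfl

/-! #### The weight table -/

variable (d : Fin K → ℕ) (v ε : Fin m → Fin m → Fin K → ℤ)

/-- Weight of the arc `u → u'` inside the pattern (`none` = penalty pair): column `i →` port
`(i, l)`: `(d l, 0)`; row `j →` column `j`: `(0, 0)`; port `(i, l) →` row `j` with `ε j i l ≠ 0`: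
`(0, −v j i l)`; port `→` itself: `(0, 0)`. -/
def arcWt (u u' : Fin m × Fin (K + 2)) : Option (ℝ × ℝ) :=
  if u.2 = 0 then
    (if u'.1 = u.1 ∧ u'.2 ≠ 0 ∧ u'.2 ≠ 1 then some (((atPort d u'.2 : ℕ) : ℝ), 0) else none)
  else if u.2 = 1 then (if u' = (u.1, 0) then some (0, 0) else none)
  else if u'.2 = 1 ∧ atPort (ε u'.1 u.1) u.2 ≠ 0 then
    some (0, -((atPort (v u'.1 u.1) u.2 : ℤ) : ℝ))
  else if u' = u then some (0, 0) else none

/-- The weight table with penalty `W` on the pairs outside the pattern. -/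
def wt (W : ℝ) (u u' : Fin m × Fin (K + 2)) : ℝ × ℝ := (arcWt d v ε u u').getD (0, -W)

/-- `θ a + b`: the functional `(x, y) ↦ θ x + y` on a weight pair. -/
def ev (θ : ℝ) (c : ℝ × ℝ) : ℝ := θ * c.1 + c.2

/-- A crude bound for all pattern contributions at slope `θ`. -/
def bnd (θ : ℝ) : ℝ :=
  ∑ u : Fin m × Fin (K + 2), ∑ u' : Fin m × Fin (K + 2), |ev θ ((arcWt d v ε u u').getD 0)|

/-- `bnd ≥ 0`. -/
theorem bnd_nonneg (θ : ℝ) : 0 ≤ bnd d v ε θ := by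
  unfold bnd
  positivity

/-- Column `i →` port `(i, l)` weighs `(d l, 0)`. -/
@[simp] theorem arcWt_col (i : Fin m) (l : Fin K) :
    arcWt d v ε (i, 0) (i, l.succ.succ) = some ((d l : ℝ), 0) := by
  simp [arcWt]

/-- Row `i →` column `i` weighs `(0, 0)`. -/
@[simp] theorem arcWt_row (i : Fin m) : arcWt d v ε (i, 1) (i, 0) = some (0, 0) := by
  simp [arcWt]

/-- Port `(i, l) →` row `j` weighs `(0, −v j i l)` when `ε j i l ≠ 0`. -/
theorem arcWt_port_row (i j : Fin m) (l : Fin K) (h : ε j i l ≠ 0) :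
    arcWt d v ε (i, l.succ.succ) (j, 1) = some (0, -(v j i l : ℝ)) := by
  simp [arcWt, h]

/-- A fixed port weighs `(0, 0)`. -/
theorem arcWt_port_self (i : Fin m) (l : Fin K) :
    arcWt d v ε (i, l.succ.succ) (i, l.succ.succ) = some (0, 0) := by
  simp [arcWt]

/-- **Score of a present term.**  On `termPerm t`, `t` present, the functional `θ x + y` of the
summed weights is the tropical weight of `t` at slope `θ`. -/
theorem score_termPerm (W : ℝ) (θ : ℤ) (t : Equiv.Perm (Fin m) × (Fin m → Fin K))
    (ht : ∀ i, ε (t.1 i) i (t.2 i) ≠ 0) :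
    ∑ u, ev θ (wt d v ε W u (termPerm t u)) = (tropWeight d v θ t : ℝ) := by
  rw [Fintype.sum_prod_type]
  simp only [tropWeight]
  push_cast
  rw [Finset.mul_sum, ← Finset.sum_sub_distrib]
  refine Finset.sum_congr rfl fun i _ => ?_
  rw [Fin.sum_univ_succ, Fin.sum_univ_succ]
  have hp : ∀ l : Fin K, ev (θ : ℝ) (wt d v ε W (i, l.succ.succ) (termPerm t (i, l.succ.succ)))
      = if l = t.2 i then -(v (t.1 i) i l : ℝ) else 0 := by
    intro l
    by_cases hl : l = t.2 i
    · subst hl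
      simp [wt, termMap, arcWt_port_row d v ε i (t.1 i) (t.2 i) (ht i), ev]
    · simp [wt, termMap, hl, arcWt_port_self, ev]
  simp only [Fin.succ_zero_eq_one, hp, Finset.sum_ite_eq', Finset.mem_univ, if_true]
  simp [wt, termMap, ev]
  ring

/-- **Penalty bound.**  A permutation using a penalty pair scores at most `bnd θ − W`. -/
theorem score_le (W θ : ℝ) (hW : 0 ≤ W) (ρ : Equiv.Perm (Fin m × Fin (K + 2)))
    (u₀ : Fin m × Fin (K + 2)) (hu₀ : arcWt d v ε u₀ (ρ u₀) = none) :
    ∑ u, ev θ (wt d v ε W u (ρ u)) ≤ bnd d v ε θ - W := by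
  have hpt : ∀ u, ev θ (wt d v ε W u (ρ u)) + (if u = u₀ then W else 0) ≤
      |ev θ ((arcWt d v ε u (ρ u)).getD 0)| := by
    intro u
    by_cases hu : u = u₀
    · subst hu; simp [wt, hu₀, ev]
    · unfold wt
      cases arcWt d v ε u (ρ u) with
      | none => simp [hu, ev, hW]
      | some c => simpa [hu] using le_abs_self (ev θ c)
  have h1 := Finset.sum_le_sum fun u (_ : u ∈ Finset.univ) => hpt u
  rw [Finset.sum_add_distrib, Finset.sum_ite_eq' Finset.univ u₀, if_pos (Finset.mem_univ _)] at h1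
  have h2 : ∑ u, |ev θ ((arcWt d v ε u (ρ u)).getD 0)| ≤ bnd d v ε θ :=
    Finset.sum_le_sum fun u _ => Finset.single_le_sum
      (f := fun u' => |ev θ ((arcWt d v ε u u').getD 0)|) (fun _ _ => abs_nonneg _)
      (Finset.mem_univ (ρ u))
  linarith

/-- The pattern arcs out of a column go to its own ports. -/
theorem of_col {i : Fin m} {u' : Fin m × Fin (K + 2)} (h : arcWt d v ε (i, 0) u' ≠ none) :
    ∃ l : Fin K, u' = (i, l.succ.succ) := by
  obtain ⟨j, b⟩ := u'
  simp [arcWt] at h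
  obtain ⟨rfl, hb0, hb1⟩ := h
  rcases fin_cases3 b with rfl | rfl | ⟨l, rfl⟩
  exacts [absurd rfl hb0, absurd rfl hb1, ⟨l, rfl⟩]

/-- The only pattern arc out of a row goes to its column. -/
theorem of_row {i : Fin m} {u' : Fin m × Fin (K + 2)} (h : arcWt d v ε (i, 1) u' ≠ none) :
    u' = (i, 0) := by
  obtain ⟨j, b⟩ := u'
  simp [arcWt] at h
  obtain ⟨rfl, rfl⟩ := h
  rfl

/-- The pattern arcs out of a port go to a row through a present entry, or are the loop. -/
theorem of_port {i : Fin m} {l : Fin K} {u' : Fin m × Fin (K + 2)}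
    (h : arcWt d v ε (i, l.succ.succ) u' ≠ none) :
    (u' = (u'.1, 1) ∧ ε u'.1 i l ≠ 0) ∨ u' = (i, l.succ.succ) := by
  obtain ⟨j, b⟩ := u'
  simp [arcWt] at h
  split_ifs at h with h1 h2
  · exact Or.inl ⟨by rw [h1.1], h1.2⟩
  · exact Or.inr (by rw [h2.1, h2.2])
  · exact absurd rfl h

/-- **Pattern lemma.**  A permutation of the nodes using no penalty pair is `termPerm t` for a
present term `t`: `λ i` is read off the image of column `i`, `σ i` off the image of the port
`(i, λ i)` (which cannot be fixed, its preimage being the column); `σ` is injective, hence a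
permutation; rows return to their columns; the remaining ports are fixed because the rows are
already the images of the ports `(i, λ i)`. -/
theorem exists_term_of_pattern (ρ : Equiv.Perm (Fin m × Fin (K + 2)))
    (h : ∀ u, arcWt d v ε u (ρ u) ≠ none) :
    ∃ t : Equiv.Perm (Fin m) × (Fin m → Fin K), (∀ i, ε (t.1 i) i (t.2 i) ≠ 0) ∧ ρ = termPerm t := by
  -- columns go to their own ports
  choose lam hlam using fun i => of_col d v ε (h (i, 0))
  -- the port `(i, λ i)` goes to a row `σ i` through a present entry
  have hport : ∀ i : Fin m, ∃ j : Fin m, ρ (i, (lam i).succ.succ) = (j, 1) ∧ ε j i (lam i) ≠ 0 := by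
    intro i
    rcases of_port d v ε (h (i, (lam i).succ.succ)) with ⟨hj, hε⟩ | hfix
    · exact ⟨_, hj, hε⟩
    · have e := ρ.injective ((hlam i).trans hfix.symm)
      simp at e
  choose σ hσ using hport
  have hσi : Function.Injective σ := by
    intro i i' hh
    have e : ρ (i, (lam i).succ.succ) = ρ (i', (lam i').succ.succ) := by
      rw [(hσ i).1, (hσ i').1, hh]
    exact congrArg Prod.fst (ρ.injective e)
  refine ⟨(Equiv.ofBijective σ hσi.bijective_of_finite, lam), fun i => (hσ i).2, ?_⟩
  ext1 ⟨i, b⟩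
  simp only [termPerm_apply, termMap, Equiv.ofBijective_apply]
  rcases fin_cases3 b with rfl | rfl | ⟨l, rfl⟩
  · simp [hlam]
  · simp [of_row d v ε (h (i, 1))]
  · by_cases hl : l = lam i
    · subst hl; simp [(hσ i).1]
    · rcases of_port d v ε (h (i, l.succ.succ)) with ⟨hj, -⟩ | hfix
      · exfalso
        obtain ⟨i', hi'⟩ := hσi.bijective_of_finite.2 (ρ (i, l.succ.succ)).1
        have e := ρ.injective (((hσ i').1.trans (by rw [hi'])).trans hj.symm)
        simp [Prod.ext_iff] at e
        obtain ⟨rfl, rfl⟩ := e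
        exact hl rfl
      · simp [hfix, hl]

/-- `termSign ε t ≠ 0` iff every entry of the term is present. -/
theorem termSign_ne_zero_iff (t : Equiv.Perm (Fin m) × (Fin m → Fin K)) :
    termSign ε t ≠ 0 ↔ ∀ i, ε (t.1 i) i (t.2 i) ≠ 0 := by
  simp [termSign, Finset.prod_eq_zero_iff]

/-! #### The linear map and the functional -/

/-- `X ↦ (∑ X_{ab} · w(b, a).1, ∑ X_{ab} · w(b, a).2)`: on the permutation matrix of `ρ` (entry
`(a, b) = 1` iff `ρ b = a`) this is `∑ᵤ w (u, ρ u)` (copy of the tree's `BirkhoffShadowLower.Lmap`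
over an arbitrary finite node type). -/
def Lmap {α : Type*} [Fintype α] (w : α → α → ℝ × ℝ) : (α × α → ℝ) →ₗ[ℝ] (Fin 2 → ℝ) where
  toFun X i := ∑ q : α × α, X q * (if i = 0 then (w q.2 q.1).1 else (w q.2 q.1).2)
  map_add' X Y := by
    ext i
    simp only [Pi.add_apply, add_mul, Finset.sum_add_distrib]
  map_smul' c X := by
    ext i
    simp only [Pi.smul_apply, smul_eq_mul, RingHom.id_apply, Finset.mul_sum, mul_assoc]

/-- `Lmap w` on the permutation matrix of `ρ`, coordinatewise. -/
theorem Lmap_perm_apply {α : Type*} [Fintype α] [DecidableEq α] (w : α → α → ℝ × ℝ)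
    (ρ : Equiv.Perm α) (i : Fin 2) :
    Lmap w (fun ij : α × α => if ρ ij.2 = ij.1 then (1 : ℝ) else 0) i =
      ∑ u, (if i = 0 then (w u (ρ u)).1 else (w u (ρ u)).2) := by
  simp only [Lmap, LinearMap.coe_mk, AddHom.coe_mk, ite_mul, one_mul, zero_mul]
  rw [Fintype.sum_prod_type_right]
  simp only [Finset.sum_ite_eq, Finset.mem_univ, if_true]

/-- The continuous linear functional `(x, y) ↦ θ x + y` on `ℝ²`. -/
def fnl (θ : ℝ) : (Fin 2 → ℝ) →L[ℝ] ℝ :=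
  θ • ContinuousLinearMap.proj 0 + ContinuousLinearMap.proj 1

/-- `fnl θ y = θ y₀ + y₁`. -/
theorem fnl_apply (θ : ℝ) (y : Fin 2 → ℝ) : fnl θ y = θ * y 0 + y 1 := by
  simp [fnl]

/-- `fnl θ ∘ Lmap w` on the permutation matrix of `ρ` is the score `∑ᵤ (θ a + b)_{w(u, ρ u)}`. -/
theorem fnl_Lmap_perm {α : Type*} [Fintype α] [DecidableEq α] (w : α → α → ℝ × ℝ)
    (ρ : Equiv.Perm α) (θ : ℝ) :
    fnl θ (Lmap w fun ij : α × α => if ρ ij.2 = ij.1 then (1 : ℝ) else 0) =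
      ∑ u, ev θ (w u (ρ u)) := by
  rw [fnl_apply, Lmap_perm_apply, Lmap_perm_apply]
  simp [ev, Finset.mul_sum, ← Finset.sum_add_distrib]

end StubShadowEmbed

open StubShadowEmbed in
/-- **Registered stub `stub_shadowEmbed`** (the embedding): `B + 1` pairwise distinct Leibniz
terms, each the unique optimum of the design at some integer slope, give `B + 1` vertices of a
plane shadow of the permutation matrices on the node set `Fin m × Fin (K + 2)` (columns, rows,
ports; pattern arcs weighted by the design, all other pairs penalised). -/
theorem stub_shadowEmbed (m K : ℕ) (d : Fin K → ℕ) (v ε : Fin m → Fin m → Fin K → ℤ) (B : ℕ)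
    (θ : Fin (B + 1) → ℤ) (p : Fin (B + 1) → Equiv.Perm (Fin m) × (Fin m → Fin K))
    (hdom : ∀ k, IsDominant d v ε (θ k) (p k)) (hp : Function.Injective p) :
    ∃ L : ((Fin m × Fin (K + 2)) × (Fin m × Fin (K + 2)) → ℝ) →ₗ[ℝ] (Fin 2 → ℝ),
      B + 1 ≤ Set.ncard (Set.extremePoints ℝ (convexHull ℝ (L ''
        {x | ∃ ρ : Equiv.Perm (Fin m × Fin (K + 2)), x = fun ij => if ρ ij.2 = ij.1 then 1 else 0}))) := by
  -- the penalty: one more than all dominant weights and all pattern contributions together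
  obtain ⟨W, hW⟩ : ∃ W : ℝ,
      W = (∑ k, (|(tropWeight d v (θ k) (p k) : ℝ)| + bnd d v ε (θ k))) + 1 := ⟨_, rfl⟩
  have h0 : ∀ k, 0 ≤ |(tropWeight d v (θ k) (p k) : ℝ)| + bnd d v ε (θ k) := fun k =>
    add_nonneg (abs_nonneg _) (bnd_nonneg d v ε _)
  have hW0 : 0 ≤ W := by rw [hW]; linarith [Finset.sum_nonneg fun k (_ : k ∈ Finset.univ) => h0 k]
  have hlt : ∀ k, bnd d v ε (θ k) - W < (tropWeight d v (θ k) (p k) : ℝ) := fun k => by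
    have h1 := Finset.single_le_sum (f := fun k => |(tropWeight d v (θ k) (p k) : ℝ)| +
      bnd d v ε (θ k)) (fun k _ => h0 k) (Finset.mem_univ k)
    have h3 := neg_abs_le (tropWeight d v (θ k) (p k) : ℝ)
    rw [hW]; linarith
  refine ⟨Lmap (wt d v ε W), ?_⟩
  set S : Set ((Fin m × Fin (K + 2)) × (Fin m × Fin (K + 2)) → ℝ) :=
    {x | ∃ ρ : Equiv.Perm (Fin m × Fin (K + 2)), x = fun ij => if ρ ij.2 = ij.1 then 1 else 0}
    with hS
  have hpres : ∀ k i, ε ((p k).1 i) i ((p k).2 i) ≠ 0 := fun k =>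
    (termSign_ne_zero_iff ε (p k)).1 (hdom k).1
  -- the vertices
  obtain ⟨z, hz⟩ : ∃ z : Fin (B + 1) → (Fin 2 → ℝ), z = fun k =>
      Lmap (wt d v ε W) (fun ij => if termPerm (p k) ij.2 = ij.1 then (1 : ℝ) else 0) := ⟨_, rfl⟩
  have hzval : ∀ k k', fnl (θ k') (z k) = (tropWeight d v (θ k') (p k) : ℝ) := fun k k' => by
    rw [hz, fnl_Lmap_perm, score_termPerm d v ε W (θ k') (p k) (hpres k)]
  have hzS : ∀ k, z k ∈ Lmap (wt d v ε W) '' S := fun k => by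
    rw [hz]; exact ⟨_, ⟨termPerm (p k), rfl⟩, rfl⟩
  -- strict unique maximality of `z k` for `fnl (θ k)` over the image set
  have hstrict : ∀ k, ∀ s ∈ Lmap (wt d v ε W) '' S, s ≠ z k → fnl (θ k) s < fnl (θ k) (z k) := by
    rintro k s ⟨x, ⟨ρ, rfl⟩, rfl⟩ hne
    rw [hzval, fnl_Lmap_perm]
    by_cases hall : ∀ u, arcWt d v ε u (ρ u) ≠ none
    · obtain ⟨t, ht, rfl⟩ := exists_term_of_pattern d v ε ρ hall
      have htne : t ≠ p k := by
        rintro rfl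
        exact hne (by rw [hz])
      rw [score_termPerm d v ε W (θ k) t ht]
      exact_mod_cast (hdom k).2 t htne ((termSign_ne_zero_iff ε t).2 ht)
    · push Not at hall
      obtain ⟨u₀, hu₀⟩ := hall
      exact lt_of_le_of_lt (score_le d v ε W (θ k) hW0 ρ u₀ hu₀) (hlt k)
  have hext : ∀ k, z k ∈ Set.extremePoints ℝ (convexHull ℝ (Lmap (wt d v ε W) '' S)) := fun k =>
    Literature.Computability.AlgebraicComplexity.BirkhoffShadowLower.mem_extremePoints_convexHull_of_forall_lt
      (fnl (θ k)) (hzS k) (hstrict k)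
  -- pairwise distinct, by dominance
  have hinj : Function.Injective z := by
    intro k j hkj
    by_contra hne
    have h1 := (hdom k).2 (p j) (fun h => hne (hp h).symm) (hdom j).1
    have h2 : fnl (θ k) (z j) = fnl (θ k) (z k) := by rw [hkj]
    rw [hzval, hzval] at h2
    have h3 : (tropWeight d v (θ k) (p j) : ℝ) < tropWeight d v (θ k) (p k) := by exact_mod_cast h1
    linarith
  -- count
  have hfin : (Set.extremePoints ℝ (convexHull ℝ (Lmap (wt d v ε W) '' S))).Finite := by
    refine Set.Finite.subset (Set.Finite.image _ ?_) extremePoints_convexHull_subset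
    have : S = Set.range fun ρ : Equiv.Perm (Fin m × Fin (K + 2)) =>
        fun ij : (Fin m × Fin (K + 2)) × (Fin m × Fin (K + 2)) =>
          if ρ ij.2 = ij.1 then (1 : ℝ) else 0 := by
      ext x
      simp only [hS, Set.mem_setOf_eq, Set.mem_range]
      constructor
      · rintro ⟨ρ, rfl⟩; exact ⟨ρ, rfl⟩
      · rintro ⟨ρ, rfl⟩; exact ⟨ρ, rfl⟩
    rw [this]
    exact Set.finite_range _
  calc B + 1 = (Set.range z).ncard := by
        rw [Set.ncard_range_of_injective hinj, Nat.card_eq_fintype_card, Fintype.card_fin]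
    _ ≤ _ := Set.ncard_le_ncard (Set.range_subset_iff.2 hext) hfin

end

end Summit.ValiantsHypothesis.ValiantsHypothesis.Theorems.LacunarySymmetroidMatrixDescartes
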